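import Mathlib.Topology.Algebra.RestrictedProduct.Units
import Mathlib.Topology.Algebra.RestrictedProduct.TopologicalSpace
import Mathlib.Topology.Algebra.ContinuousMonoidHom
import Mathlib.Topology.Algebra.Group.Units
import Mathlib.RingTheory.DedekindDomain.FiniteAdeleRing
import HarnessLib

/-!
# Units of a restricted product are the restricted product of the units — topologically

Topic `Topology/Algebra/RestrictedProduct`. Mathlib's
`RestrictedProduct.unitsEquiv : (Πʳ i, [R i, B i])ˣ ≃* Πʳ i, [(R i)ˣ, (B i).units]` is an isomorphism of
monoids only. For topological monoids `R i` with OPEN submonoids `B i` it is an isomorphism of TOPOLOGICAL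
groups — the units carrying Mathlib's units topology (the embedding `u ↦ (u, u⁻¹)` into `R × Rᵐᵒᵖ`), the
right-hand side the restricted-product topology:

* `continuous_of_isOpenMap_comp` — a homomorphism of topological groups is continuous as soon as its composite
  with some OPEN map `i` with `i p₀ = 1` is continuous at `p₀`;
* `Units.isOpenEmbedding_map` — **units of an open embedding of topological monoids form an open embedding**
  (for the units topologies); `Units.range_map_eq_of_injective`;
* `structureMonoidHom`, `isOpenEmbedding_structureMonoidHom` — Mathlib's structure map `Π i, B i → Πʳ i, [R i, B i]`
  as a monoid homomorphism, an open embedding (`RestrictedProduct.isOpenEmbedding_structureMap`);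
* **`unitsContinuousMulEquiv R B : (Πʳ i, [R i, B i])ˣ ≃ₜ* Πʳ i, [(R i)ˣ, (B i).units]`** — continuity of
  `unitsEquiv` is tested on the open subgroup `(Π i, B i)ˣ ↪ (Πʳ i, [R i, B i])ˣ`, continuity of its inverse on
  the open subgroup `Π i, (B i).units ↪ Πʳ i, [(R i)ˣ, (B i).units]`, where both composites are products of
  coordinate maps;
* `finiteAdeleUnitsEquiv R K : (FiniteAdeleRing R K)ˣ ≃ₜ* Πʳ v, [(K_v)ˣ, (𝒪_v).units]` — **the finite ideles of
  a Dedekind domain ARE the restricted product of the `K_vˣ` with respect to the `𝒪_vˣ`, as topological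
  groups** (Cassels–Fröhlich (1967), Ch. II (Cassels, "Global fields") §16, p. 68: the idele topology is the
  restricted-product topology, NOT the subspace topology from the adeles [CasselsFrohlichANT1967]).

Everything is proved (Mathlib only); no global instances (the two `Fact`s Mathlib's restricted-product group
instances consume are recorded as theorems `fact_isOpen_units`, `fact_isOpen_adicCompletionIntegers` and
used via `haveI`).

## Provenance

Reproduced for the tree under the LEAN-IN-TREE rule (2026-08-18) from the pub-hodgecm cell's package files
`HodgeCM/PerL34/RestrictedUnits.lean` §§1–3 (DAG-node prover #09 lineage, seat pv09-g4, gate run 26; 240 lines;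
its number-field corollary `ideleGroupEquiv`, which needs the package's `NumberField.ideleGroupSplit`, is not
reproduced) and `HodgeCM/PerL34/IdeleClassGroup.lean` ll. 37–79 (prover #10 lineage, seat pv10, gate run 20: the
`Units` lemmas), verbatim up to the namespaces (`HodgeCM.PerL34.RestrictedUnits` ↦
`Literature.Topology.Algebra.RestrictedProduct`; root `Units` ↦ `Literature.Topology.Algebra.RestrictedProduct.Units`),
the two `instance` ↦ `theorem` changes just described, and the added docstrings.
-/

set_option autoImplicit false

noncomputable section

open _root_.Topology Filter Set
open scoped RestrictedProduct

namespace Literature.Topology.Algebra.RestrictedProduct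

namespace Units

variable {A R : Type*} [Monoid A] [Monoid R] [TopologicalSpace A] [TopologicalSpace R]

omit [TopologicalSpace A] [TopologicalSpace R] in
/-- The range of `Units.map f` for an injective `f` is cut out by `val ∈ range f ∧ val⁻¹ ∈ range f`. [folklore] -/
theorem range_map_eq_of_injective (f : A →* R) (hf : Function.Injective f) :
    Set.range (Units.map f) =
      (fun u : Rˣ => (u : R)) ⁻¹' Set.range f ∩ (fun u : Rˣ => ((u⁻¹ : Rˣ) : R)) ⁻¹' Set.range f := by
  ext u
  constructor
  · rintro ⟨a, rfl⟩
    exact ⟨⟨(a : A), rfl⟩, ⟨((a⁻¹ : Aˣ) : A), by simp⟩⟩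
  · rintro ⟨⟨a, ha⟩, ⟨b, hb⟩⟩
    have hab : a * b = 1 := hf (by rw [map_mul, ha, hb, map_one, Units.mul_inv])
    have hba : b * a = 1 := hf (by rw [map_mul, ha, hb, map_one, Units.inv_mul])
    exact ⟨⟨a, b, hab, hba⟩, Units.ext ha⟩

/-- **Units of an open embedding of topological monoids form an open embedding.**  (For an open
subring `A ⊆ R`, e.g. `∏_v 𝒪_v ⊆ 𝔸_{K,f}`, this says `A^× ⊆ R^×` is open, for the units topologies.) [folklore] -/
theorem isOpenEmbedding_map (f : A →* R) (hf : IsOpenEmbedding f) :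
    IsOpenEmbedding (Units.map f) := by
  -- inducing: `embedProduct R ∘ map f = (f × fᵒᵖ) ∘ Units.embedProduct A` with all three inducing
  have hop : IsInducing (fun x : Aᵐᵒᵖ => MulOpposite.op (f (MulOpposite.unop x))) :=
    MulOpposite.opHomeomorph.isInducing.comp
      (hf.isInducing.comp MulOpposite.opHomeomorph.symm.isInducing)
  have hprod : IsInducing (Prod.map f (fun x : Aᵐᵒᵖ => MulOpposite.op (f (MulOpposite.unop x)))) :=
    hf.isInducing.prodMap hop
  have hcomp : (Units.embedProduct R) ∘ (Units.map f) =
      (Prod.map f (fun x : Aᵐᵒᵖ => MulOpposite.op (f (MulOpposite.unop x)))) ∘ Units.embedProduct A := by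
    funext u
    simp [Units.embedProduct]
  have hind : IsInducing (Units.map f) := by
    rw [← Units.isInducing_embedProduct.of_comp_iff, hcomp]
    exact hprod.comp Units.isInducing_embedProduct
  refine ⟨⟨hind, ?_⟩, ?_⟩
  · intro u v huv
    exact Units.ext (hf.injective (by simpa using congrArg (fun w : Rˣ => (w : R)) huv))
  · rw [range_map_eq_of_injective f hf.injective]
    exact (hf.isOpen_range.preimage Units.continuous_val).inter
      (hf.isOpen_range.preimage Units.continuous_coe_inv)

end Units

/-! ## §1  A continuity criterion for homomorphisms -/

section general

/-- A homomorphism of topological groups is continuous as soon as its composite with some OPEN map `i`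
hitting `1` at `p₀` is continuous at `p₀`. [folklore] -/
theorem continuous_of_isOpenMap_comp {G H P : Type*} [Group G] [TopologicalSpace G] [IsTopologicalGroup G]
    [Group H] [TopologicalSpace H] [IsTopologicalGroup H] [TopologicalSpace P] (f : G →* H) (i : P → G)
    (hi : IsOpenMap i) {p₀ : P} (hp : i p₀ = 1) (hc : ContinuousAt (f ∘ i) p₀) : Continuous f := by
  refine continuous_of_continuousAt_one f ?_
  rw [ContinuousAt, ← hp]
  intro N hN
  have hN' : (f ∘ i) ⁻¹' N ∈ 𝓝 p₀ := hc hN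
  obtain ⟨O, hO, hOo, hp₀⟩ := mem_nhds_iff.mp hN'
  refine Filter.mem_map.mpr (mem_of_superset ((hi O hOo).mem_nhds ⟨p₀, hp₀, rfl⟩) ?_)
  rintro _ ⟨p, hp, rfl⟩
  exact hO hp

end general

/-! ## §2  `(Πʳ i, [R i, B i])ˣ ≃ₜ* Πʳ i, [(R i)ˣ, (B i).units]` -/

section units

variable {ι : Type*} {R : ι → Type*} [∀ i, Monoid (R i)] [∀ i, TopologicalSpace (R i)]
  {S : ι → Type*} [∀ i, SetLike (S i) (R i)] [∀ i, SubmonoidClass (S i) (R i)] {B : ∀ i, S i}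

/-- The open submonoids `B i` have open unit groups `(B i).units ⊆ (R i)ˣ`. [folklore] -/
theorem isOpen_units_ofClass (hBo : ∀ i, IsOpen (B i : Set (R i))) (i : ι) :
    IsOpen (((Submonoid.ofClass (B i)).units : Subgroup (R i)ˣ) : Set (R i)ˣ) :=
  Submonoid.isOpen_units (U := Submonoid.ofClass (B i)) (hBo i)

/-- The structure map `Π i, B i → Πʳ i, [R i, B i]` as a monoid homomorphism. [folklore] -/
def structureMonoidHom : (Π i, B i) →* Πʳ i, [R i, B i] where
  toFun := RestrictedProduct.structureMap R (fun i => (B i : Set (R i))) cofinite ∘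
    fun x i => (⟨(x i : R i), (x i).2⟩ : (B i : Set (R i)))
  map_one' := rfl
  map_mul' _ _ := rfl

omit [∀ i, TopologicalSpace (R i)] in
/-- Components of the structure homomorphism. [folklore] -/
theorem structureMonoidHom_apply (x : Π i, B i) (i : ι) : structureMonoidHom (B := B) x i = (x i : R i) :=
  rfl

/-- The structure homomorphism `Π i, B i → Πʳ i, [R i, B i]` is an open embedding (Mathlib
`RestrictedProduct.isOpenEmbedding_structureMap`). [folklore] -/
theorem isOpenEmbedding_structureMonoidHom (hBo : ∀ i, IsOpen (B i : Set (R i))) :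
    IsOpenEmbedding (structureMonoidHom (B := B)) := by
  have h1 : IsOpenEmbedding (RestrictedProduct.structureMap R (fun i => (B i : Set (R i))) cofinite) :=
    RestrictedProduct.isOpenEmbedding_structureMap hBo
  have h2 : IsOpenEmbedding (fun (x : Π i, B i) (i : ι) => (⟨(x i : R i), (x i).2⟩ : (B i : Set (R i)))) :=
    (Homeomorph.piCongrRight fun i => (Homeomorph.setCongr rfl : (B i : Set (R i)) ≃ₜ (B i : Set (R i)))).isOpenEmbedding
  exact h1.comp h2

/-- The coordinate unit `(x i : (R i)ˣ)` of a unit `x` of `Π i, B i`, inside `(B i).units`. [folklore] -/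
def piUnitCoord (x : (Π i, B i)ˣ) (i : ι) : ((Submonoid.ofClass (B i)).units : Subgroup (R i)ˣ) :=
  ⟨⟨(x.1 i : R i), (x.2 i : R i), by
      have h := congrArg (fun y : Π i, B i => (y i : R i)) x.3
      simpa using h, by
      have h := congrArg (fun y : Π i, B i => (y i : R i)) x.4
      simpa using h⟩,
    (Submonoid.mem_units_iff _ _).mpr ⟨(x.1 i).2, (x.2 i).2⟩⟩

/-- The coordinate units depend continuously on the unit of `Π i, B i`. [folklore] -/
theorem continuous_piUnitCoord (i : ι) : Continuous fun x : (Π i, B i)ˣ => piUnitCoord x i := by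
  refine Continuous.subtype_mk ?_ _
  refine Units.continuous_iff.mpr ⟨?_, ?_⟩
  · exact (continuous_subtype_val.comp ((continuous_apply i).comp Units.continuous_val))
  · exact (continuous_subtype_val.comp ((continuous_apply i).comp Units.continuous_coe_inv))

variable [∀ i, ContinuousMul (R i)] [hBopen : Fact (∀ i, IsOpen (B i : Set (R i)))]

omit [∀ i, ContinuousMul (R i)] in
/-- The `Fact` that the unit groups `(B i).units` are open, consumed by Mathlib's topological-group
structures on `Πʳ i, [(R i)ˣ, (B i).units]` (recorded as a theorem; used via `haveI` below — make it a
local instance where the group structure of the right-hand side is needed). [folklore] -/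
theorem fact_isOpen_units :
    Fact (∀ i, IsOpen (((Submonoid.ofClass (B i)).units : Subgroup (R i)ˣ) : Set (R i)ˣ)) :=
  ⟨isOpen_units_ofClass hBopen.out⟩

/-- `unitsEquiv` is continuous (units topology → restricted product topology). [folklore] -/
theorem continuous_unitsEquiv :
    Continuous (RestrictedProduct.unitsEquiv R (B := B) (𝓕 := cofinite)) := by
  classical
  haveI := fact_isOpen_units (B := B)
  -- test on the open subgroup `(Π i, B i)ˣ ↪ (Πʳ i, [R i, B i])ˣ`
  have hopen : IsOpenEmbedding (Units.map (structureMonoidHom (B := B))) :=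
    Units.isOpenEmbedding_map _ (isOpenEmbedding_structureMonoidHom hBopen.out)
  refine continuous_of_isOpenMap_comp (RestrictedProduct.unitsEquiv R (B := B) (𝓕 := cofinite)).toMonoidHom
    (Units.map (structureMonoidHom (B := B))) hopen.isOpenMap (p₀ := 1) (map_one _) ?_
  -- the composite is `structureMap ∘ piUnitCoord`, a continuous map
  have hcomp : ((RestrictedProduct.unitsEquiv R (B := B) (𝓕 := cofinite)).toMonoidHom ∘
      Units.map (structureMonoidHom (B := B)) : (Π i, B i)ˣ → _) =
      RestrictedProduct.structureMap (fun i => (R i)ˣ)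
        (fun i => (((Submonoid.ofClass (B i)).units : Subgroup (R i)ˣ) : Set (R i)ˣ)) cofinite ∘
        fun x i => piUnitCoord x i := by
    funext x
    ext i
    rfl
  rw [hcomp]
  exact ((RestrictedProduct.isEmbedding_structureMap.continuous).comp
    (continuous_pi fun i => continuous_piUnitCoord i)).continuousAt

/-- `unitsEquiv.symm` is continuous (restricted product topology → units topology). [folklore] -/
theorem continuous_unitsEquiv_symm :
    Continuous (RestrictedProduct.unitsEquiv R (B := B) (𝓕 := cofinite)).symm := by
  classical
  haveI := fact_isOpen_units (B := B)
  have hopen : IsOpenEmbedding (RestrictedProduct.structureMap (fun i => (R i)ˣ)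
      (fun i => (((Submonoid.ofClass (B i)).units : Subgroup (R i)ˣ) : Set (R i)ˣ)) cofinite) :=
    RestrictedProduct.isOpenEmbedding_structureMap (isOpen_units_ofClass hBopen.out)
  refine continuous_of_isOpenMap_comp (RestrictedProduct.unitsEquiv R (B := B) (𝓕 := cofinite)).symm.toMonoidHom
    _ hopen.isOpenMap (p₀ := 1) rfl ?_
  refine Continuous.continuousAt ?_
  refine Units.continuous_iff.mpr ⟨?_, ?_⟩
  · -- `x ↦ (i ↦ (x i : R i))` = structureMap ∘ coordinatewise `val`
    have h : (Units.val ∘ ((RestrictedProduct.unitsEquiv R (B := B) (𝓕 := cofinite)).symm.toMonoidHom ∘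
        RestrictedProduct.structureMap (fun i => (R i)ˣ)
          (fun i => (((Submonoid.ofClass (B i)).units : Subgroup (R i)ˣ) : Set (R i)ˣ)) cofinite)) =
        RestrictedProduct.structureMap R (fun i => (B i : Set (R i))) cofinite ∘
          fun x i => (⟨((x i : (R i)ˣ) : R i), ((Submonoid.mem_units_iff _ _).mp (x i).2).1⟩ :
            (B i : Set (R i))) := by
      funext x
      rfl
    rw [h]
    exact RestrictedProduct.isEmbedding_structureMap.continuous.comp
      (continuous_pi fun i => (Units.continuous_val.comp (continuous_subtype_val.comp
        (continuous_apply i))).subtype_mk _)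
  · change Continuous (RestrictedProduct.structureMap R (fun i => (B i : Set (R i))) cofinite ∘
          fun (x : Π i, (((Submonoid.ofClass (B i)).units : Subgroup (R i)ˣ) : Set (R i)ˣ)) (i : ι) =>
            (⟨(((x i : (R i)ˣ)⁻¹ : (R i)ˣ) : R i), ((Submonoid.mem_units_iff _ _).mp (x i).2).2⟩ :
            (B i : Set (R i))))
    exact RestrictedProduct.isEmbedding_structureMap.continuous.comp
      (continuous_pi fun i => (Units.continuous_coe_inv.comp (continuous_subtype_val.comp
        (continuous_apply i))).subtype_mk _)

variable (R B) in
/-- **Units of a restricted product = restricted product of the units, as TOPOLOGICAL groups** (for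
topological monoids `R i` with open submonoids `B i`). [folklore] -/
def unitsContinuousMulEquiv :
    (Πʳ i, [R i, B i])ˣ ≃ₜ* Πʳ i, [(R i)ˣ, (Submonoid.ofClass (B i)).units] :=
  { RestrictedProduct.unitsEquiv R (B := B) (𝓕 := cofinite) with
    continuous_toFun := continuous_unitsEquiv
    continuous_invFun := continuous_unitsEquiv_symm }

/-- Components of `unitsContinuousMulEquiv` are those of Mathlib's `unitsEquiv`. [folklore] -/
@[simp] theorem unitsContinuousMulEquiv_apply (x : (Πʳ i, [R i, B i])ˣ) (i : ι) :
    unitsContinuousMulEquiv R B x i = RestrictedProduct.unitsEquiv R x i := rfl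

/-- `((unitsContinuousMulEquiv x) i : R i) = x i`. [folklore] -/
theorem coe_unitsContinuousMulEquiv_apply (x : (Πʳ i, [R i, B i])ˣ) (i : ι) :
    ((unitsContinuousMulEquiv R B x i : (R i)ˣ) : R i) = (x : Πʳ i, [R i, B i]) i := rfl

end units

/-! ## §3  Finite ideles and ideles -/

section ideles

open IsDedekindDomain NumberField

variable (R K : Type*) [CommRing R] [IsDedekindDomain R] [Field K] [Algebra R K] [IsFractionRing R K]

/-- `𝒪_v ⊆ K_v` is open (Mathlib `Valued.isOpen_valuationSubring`), as the `Fact` consumed by Mathlib's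
restricted-product instances (a theorem, as in Mathlib's `FiniteAdeleRing` and the tree's
`Literature.NumberTheory.Automorphic.fact_isOpen_adicCompletionIntegers` for `R = 𝓞 K`). [folklore] -/
theorem fact_isOpen_adicCompletionIntegers :
    Fact (∀ v : HeightOneSpectrum R, IsOpen ((v.adicCompletionIntegers K : Set (v.adicCompletion K)))) :=
  ⟨fun _ => Valued.isOpen_valuationSubring _⟩

/-- **The finite ideles are the restricted product of the `K_vˣ` with respect to the `𝒪_vˣ`**, as
topological groups. [folklore] -/
def finiteAdeleUnitsEquiv :
    (FiniteAdeleRing R K)ˣ ≃ₜ*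
      Πʳ v : HeightOneSpectrum R, [(v.adicCompletion K)ˣ,
        (Submonoid.ofClass (v.adicCompletionIntegers K)).units] :=
  haveI := fact_isOpen_adicCompletionIntegers R K
  unitsContinuousMulEquiv (fun v : HeightOneSpectrum R => v.adicCompletion K)
    (fun v : HeightOneSpectrum R => v.adicCompletionIntegers K)

/-- `((finiteAdeleUnitsEquiv x) v : K_v) = x v`. [folklore] -/
theorem coe_finiteAdeleUnitsEquiv_apply (x : (FiniteAdeleRing R K)ˣ) (v : HeightOneSpectrum R) :
    ((finiteAdeleUnitsEquiv R K x v : (v.adicCompletion K)ˣ) : v.adicCompletion K) =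
      (x : FiniteAdeleRing R K) v := rfl

end ideles

end Literature.Topology.Algebra.RestrictedProduct
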